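import Summits.CriticalPhenomena.PercolationContinuityZ3.Theses.PercNonProliferation
import Literature.Probability.Percolation.CerfUniquenessZoneBound
import Literature.Probability.Percolation.KozmaNitzanTargetLemma
import Literature.Probability.Percolation.RSW
import HarnessLib

/-!
# Crux `PercNonProliferation.NonProliferation` (stmt-CriticalPhenomena-4444),
# line `boundary-pinning` — stub `stub_innerTwoArmDecay`

Helper file for the lead's skeleton of line `boundary-pinning` (payload slug `Sketch`,
prover-line-stmt-CriticalPhenomena-4444-c1). Proves exactly the registered stub signature
`stub_innerTwoArmDecay`; lands with `--supports stmt-CriticalPhenomena-4444`.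

The statement: for `d ≥ 2` there are `α > 0` and `n₁` such that for `n ≥ n₁` every cell
`Q ⊆ B(n)` of coordinate-diameter `≤ ⌊n^α⌋` carries the inner two-DISTINCT-crosser event
(two points `u, v ∈ Q`, each joined inside `B(2n)` to `∂ⁱⁿB(2n)`, not joined to each other
inside `B(2n)`) with `P_{p_c(ℤ^d)}`-probability `≤ n^{-α}`.

Proof (the in-tree DKT/Cerf uniqueness zone, translated). Take `δ := min (p_c, 1 - p_c) > 0`
(`criticalProb_zd_pos`, `criticalProb_zd_lt_one`) and `α ∈ (0,1)`, `n₁` from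
`AKN.dkt_prop1`: `P_p((uniqZone ⌊n^α⌋ n)ᶜ) ≤ n^{-α}` for `n ≥ n₁`, `p ∈ [δ, 1-δ]`. For a
non-empty cell pick `z ∈ Q ⊆ B(n)`; then `Q ⊆ z + Λ_k` (`k = ⌊n^α⌋ ≤ n`) and
`z + Λ_n ⊆ B(2n)` (`AKN.ball_subset_box_of_le`). On lattice configurations the event lies in
`(uniqZoneAt z k n)ᶜ` (`StubInnerTwoArmDecay.notMem_uniqZoneAt`): an open path inside `B(2n)`
from `u ∈ z + Λ_n` to `a ∈ ∂ⁱⁿB(2n)` either leaves the ball `z + Λ_n` — its first exit is a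
point of `∂ⁱⁿ(z + Λ_n)` reached inside the ball — or stays inside, in which case `a` itself
lies on `∂ⁱⁿ(z + Λ_n)` (its neighbour outside `B(2n)` is outside the ball) (`PathIn.exit_or`,
`StubInnerTwoArmDecay.toBdryAt_of_openConnIn`); two such `u, v` joined inside the ball would be
joined inside `B(2n)` (`openConnIn_mono`). Finally
`P((uniqZoneAt z k n)ᶜ) = P((uniqZone k n)ᶜ) ≤ n^{-α}` by translation invariance
(`KozmaNitzan.real_uniqZoneAt_eq`) and complements (`probReal_compl_eq_one_sub`); the empty
cell carries the empty event.
-/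

noncomputable section

namespace Summit.CriticalPhenomena.PercolationContinuityZ3.Theorems.NonProliferation

open MeasureTheory Filter Topology
open Literature.Probability.LatticeModels Literature.Probability.Percolation

namespace StubInnerTwoArmDecay

/-- **First exit from the ball.** For a lattice configuration `ω ⊆ E(ℤ^d)`, `z ∈ B(n)` and
`u ∈ z + Λ_n`: if `u` is joined inside `B(2n)` to a point `a` of `∂ⁱⁿB(2n)`, then `u` is
joined inside the ball `z + Λ_n` to a point of its inner vertex boundary
(`ω ∈ toBdryAt z n u`). Either the open path leaves the ball, and its first exit edge `a' ∼ b`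
has `a' ∈ ∂ⁱⁿ(z + Λ_n)` reached inside the ball, or it stays inside the ball, and then
`a ∈ z + Λ_n` has its neighbour outside `B(2n) ⊇ z + Λ_n`, so `a ∈ ∂ⁱⁿ(z + Λ_n)`. -/
theorem toBdryAt_of_openConnIn {d n : ℕ} {z u a : Site d} {ω : BondConfig (Site d)}
    (hω : ω ⊆ (zdGraph d).edgeSet) (hz : z ∈ box d n) (hu : u ∈ GM.ball z n)
    (ha : a ∈ innerBoundary (zdGraph d) (box d (2 * n)))
    (h : ω ∈ openConnIn (↑(box d (2 * n)) : Set (Site d)) u a) :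
    ω ∈ KozmaNitzan.toBdryAt z n u := by
  rw [DCT16.mem_openConnIn_iff_pathIn] at h
  rcases h.exit_or (R := (↑(GM.ball z n) : Set (Site d))) (Finset.mem_coe.2 hu) with
    h' | ⟨a', b, ha', hb, -, hab, hpath⟩
  · -- the path stays inside the ball: `a` itself is on the ball's inner boundary
    have haR : a ∈ GM.ball z n := Finset.mem_coe.1 h'.right_mem.1
    refine ⟨a, ?_, ?_⟩
    · rw [mem_innerBoundary_iff] at ha ⊢
      obtain ⟨-, y, hy, hay⟩ := ha
      exact ⟨haR, y, fun hy' => hy (AKN.ball_subset_box_of_le le_rfl hz hy'), hay⟩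
    · rw [DCT16.mem_openConnIn_iff_pathIn]
      exact h'.mono Set.inter_subset_left
  · -- the path leaves the ball: its first exit
    refine ⟨a', ?_, ?_⟩
    · rw [mem_innerBoundary_iff]
      exact ⟨Finset.mem_coe.1 ha', b, fun hb' => hb (Finset.mem_coe.2 hb'),
        DCT16.adj_of_openGraph_adj hω hab⟩
    · rw [DCT16.mem_openConnIn_iff_pathIn]
      exact hpath.mono Set.inter_subset_left

/-- **The inner two-distinct-crosser event violates the translated uniqueness zone.** For
`k ≤ n`, `z ∈ Q ⊆ B(n)` with `Q` of coordinate-diameter `≤ k` (so `Q ⊆ z + Λ_k ⊆ z + Λ_n`)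
and a lattice configuration `ω`: two points `u, v ∈ Q` each joined inside `B(2n)` to
`∂ⁱⁿB(2n)` reach `∂ⁱⁿ(z + Λ_n)` inside `z + Λ_n` (`toBdryAt_of_openConnIn`); if they are not
joined inside `B(2n)`, they are not joined inside `z + Λ_n ⊆ B(2n)` either, so
`ω ∉ uniqZoneAt z k n`. -/
theorem notMem_uniqZoneAt {d n k : ℕ} (hkn : k ≤ n) {Q : Finset (Site d)} {z : Site d}
    (hz : z ∈ Q) (hQ : Q ⊆ box d n)
    (hdiam : ∀ u ∈ Q, ∀ v ∈ Q, ∀ i : Fin d, |u i - v i| ≤ (k : ℤ))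
    {ω : BondConfig (Site d)} (hω : ω ⊆ (zdGraph d).edgeSet)
    (hev : ω ∈ {ω : BondConfig (Site d) | ∃ u ∈ Q, ∃ v ∈ Q,
      (∃ a ∈ innerBoundary (zdGraph d) (box d (2 * n)),
        ω ∈ openConnIn (↑(box d (2 * n)) : Set (Site d)) u a) ∧
      (∃ b ∈ innerBoundary (zdGraph d) (box d (2 * n)),
        ω ∈ openConnIn (↑(box d (2 * n)) : Set (Site d)) v b) ∧
      ω ∉ openConnIn (↑(box d (2 * n)) : Set (Site d)) u v}) :
    ω ∈ (KozmaNitzan.uniqZoneAt z k n)ᶜ := by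
  obtain ⟨u, hu, v, hv, ⟨a, ha, hua⟩, ⟨b, hb, hvb⟩, huv⟩ := hev
  intro hU
  have hzn : z ∈ box d n := hQ hz
  have hkn' : (k : ℤ) ≤ n := by exact_mod_cast hkn
  have hballk : ∀ w ∈ Q, w ∈ GM.ball z k := fun w hw =>
    GM.mem_ball.2 fun i => abs_le.1 (hdiam w hw z hz i)
  have hballn : ∀ w ∈ Q, w ∈ GM.ball z n := fun w hw =>
    GM.mem_ball.2 fun i => by
      have h := abs_le.1 (hdiam w hw z hz i)
      constructor <;> omega
  have hin := hU u (hballk u hu) v (hballk v hv)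
    (toBdryAt_of_openConnIn hω hzn (hballn u hu) ha hua)
    (toBdryAt_of_openConnIn hω hzn (hballn v hv) hb hvb)
  exact huv
    (openConnIn_mono (Finset.coe_subset.2 (AKN.ball_subset_box_of_le le_rfl hzn)) u v hin)

/-- `⌊n^α⌋ ≤ n` for `n ≥ 1` and `α ≤ 1`. -/
theorem floor_rpow_le {n : ℕ} (hn : 1 ≤ n) {α : ℝ} (hα : α ≤ 1) :
    ⌊(n : ℝ) ^ α⌋₊ ≤ n := by
  have hn' : (1 : ℝ) ≤ n := by exact_mod_cast hn
  have h1 : (n : ℝ) ^ α ≤ n := by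
    calc (n : ℝ) ^ α ≤ (n : ℝ) ^ (1 : ℝ) := Real.rpow_le_rpow_of_exponent_le hn' hα
      _ = n := Real.rpow_one _
  calc ⌊(n : ℝ) ^ α⌋₊ ≤ ⌊((n : ℕ) : ℝ)⌋₊ := Nat.floor_mono h1
    _ = n := Nat.floor_natCast n

end StubInnerTwoArmDecay

/-- **Stub `stub_innerTwoArmDecay`** of line `boundary-pinning` (crux
stmt-CriticalPhenomena-4444): for `d ≥ 2` there are `α > 0` and `n₁` such that for `n ≥ n₁`
every cell `Q ⊆ B(n)` of coordinate-diameter `≤ ⌊n^α⌋` carries the inner two-distinct-crosser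
event with probability `≤ n^{-α}` at `p_c(ℤ^d)`. With `δ = min (p_c, 1 - p_c) > 0` and `α, n₁`
from `AKN.dkt_prop1`, for a non-empty cell pick `z ∈ Q`: on lattice configurations the event
lies in `(uniqZoneAt z ⌊n^α⌋ n)ᶜ` (`StubInnerTwoArmDecay.notMem_uniqZoneAt`), whose probability
is that of `(uniqZone ⌊n^α⌋ n)ᶜ` (translation invariance `KozmaNitzan.real_uniqZoneAt_eq`),
`≤ n^{-α}`. -/
theorem stub_innerTwoArmDecay :
  ∀ d : ℕ, 2 ≤ d → ∃ α : ℝ, 0 < α ∧ ∃ n₁ : ℕ, ∀ n : ℕ, n₁ ≤ n →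
    ∀ Q : Finset (Site d), Q ⊆ box d n →
      (∀ u ∈ Q, ∀ v ∈ Q, ∀ i : Fin d, |u i - v i| ≤ ((⌊(n : ℝ) ^ α⌋₊ : ℕ) : ℤ)) →
      (bondPercolation (zdGraph d) (criticalProbI d)).real
        {ω | ∃ u ∈ Q, ∃ v ∈ Q,
          (∃ a ∈ innerBoundary (zdGraph d) (box d (2 * n)),
            ω ∈ openConnIn (↑(box d (2 * n)) : Set (Site d)) u a) ∧
          (∃ b ∈ innerBoundary (zdGraph d) (box d (2 * n)),
            ω ∈ openConnIn (↑(box d (2 * n)) : Set (Site d)) v b) ∧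
          ω ∉ openConnIn (↑(box d (2 * n)) : Set (Site d)) u v} ≤ (n : ℝ) ^ (-α) := by
  intro d hd
  have hd1 : 1 ≤ d := by omega
  -- `δ := min (p_c, 1 - p_c) > 0`
  obtain ⟨pc, hpc⟩ : ∃ pc : ℝ, pc = ((criticalProbI d : unitInterval) : ℝ) := ⟨_, rfl⟩
  have hpc0 : 0 < pc := by
    rw [hpc, coe_criticalProbI]; exact criticalProb_zd_pos d hd1
  have hpc1 : pc < 1 := by
    rw [hpc, coe_criticalProbI]; exact criticalProb_zd_lt_one hd
  have hδ : (0 : ℝ) < min pc (1 - pc) := lt_min hpc0 (sub_pos.2 hpc1)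
  obtain ⟨α, hα0, hα1, n₁, hdkt⟩ := AKN.dkt_prop1 (d := d) hd1 hδ
  refine ⟨α, hα0, max n₁ 1, fun n hn Q hQ hdiam => ?_⟩
  have hn₁ : n₁ ≤ n := le_of_max_le_left hn
  have hn1 : 1 ≤ n := le_of_max_le_right hn
  -- the uniqueness-zone bound at `p = p_c ∈ [δ, 1 - δ]`
  have hbound : (bondPercolation (zdGraph d) (criticalProbI d)).real
      (uniqZone (d := d) ⌊(n : ℝ) ^ α⌋₊ n)ᶜ ≤ (n : ℝ) ^ (-α) :=
    hdkt n hn₁ (criticalProbI d) (by rw [← hpc]; exact min_le_left _ _)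
      (by rw [← hpc]; linarith [min_le_right pc (1 - pc)])
  rcases Q.eq_empty_or_nonempty with rfl | ⟨z, hz⟩
  · -- the empty cell carries the empty event
    simp only [Finset.notMem_empty, false_and, exists_false, Set.setOf_false, measureReal_empty]
    exact Real.rpow_nonneg (Nat.cast_nonneg n) _
  · have hkn : ⌊(n : ℝ) ^ α⌋₊ ≤ n := StubInnerTwoArmDecay.floor_rpow_le hn1 hα1.le
    calc (bondPercolation (zdGraph d) (criticalProbI d)).real
          {ω | ∃ u ∈ Q, ∃ v ∈ Q,
            (∃ a ∈ innerBoundary (zdGraph d) (box d (2 * n)),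
              ω ∈ openConnIn (↑(box d (2 * n)) : Set (Site d)) u a) ∧
            (∃ b ∈ innerBoundary (zdGraph d) (box d (2 * n)),
              ω ∈ openConnIn (↑(box d (2 * n)) : Set (Site d)) v b) ∧
            ω ∉ openConnIn (↑(box d (2 * n)) : Set (Site d)) u v}
        ≤ (bondPercolation (zdGraph d) (criticalProbI d)).real
            (KozmaNitzan.uniqZoneAt z ⌊(n : ℝ) ^ α⌋₊ n)ᶜ :=
          DCT16.real_mono_of_forall_subset_edgeSet (zdGraph d) _ fun ω hω hωE =>
            StubInnerTwoArmDecay.notMem_uniqZoneAt hkn hz hQ hdiam hω hωE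
      _ = (bondPercolation (zdGraph d) (criticalProbI d)).real
            (uniqZone (d := d) ⌊(n : ℝ) ^ α⌋₊ n)ᶜ := by
          rw [probReal_compl_eq_one_sub (KozmaNitzan.measurableSet_uniqZoneAt z _ n),
            probReal_compl_eq_one_sub (measurableSet_uniqZone _ n),
            KozmaNitzan.real_uniqZoneAt_eq]
      _ ≤ (n : ℝ) ^ (-α) := hbound

end Summit.CriticalPhenomena.PercolationContinuityZ3.Theorems.NonProliferation

end
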